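import Summits.BirchSwinnertonDyer.BirchSwinnertonDyer.Theses.ShadowIsolation

/-!
# Crux `ShaCotorsionReducible` (stmt-BirchSwinnertonDyer-15277) — birth skeleton `Lines/birth.lean`

Route `ShadowIsolation` (route-BirchSwinnertonDyer-ShadowIsolation), crux #7 (rank 7, the RESIDUAL
EISENSTEIN SECTOR): for `W/ℚ` globally minimal elliptic and a prime `p ≥ 5` of good ordinary
reduction at which `E[p]` is REDUCIBLE (`E` admits a rational `p`-isogeny; by Mazur 1978, Thm. 1,
`p ∈ {5, 7, 11, 13, 17, 19, 37, 43, 67, 163}` — infinite families for `p ∈ {5, 7, 13}`, where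
`X₀(p)` has genus `0`, finitely many `j`-invariants up to twist otherwise, several of which have bad
reduction at `p` and drop out), `corank_{ℤ_p} Ш(E/ℚ)[p^∞] = 0` (`W.shaCorank p = 0`). The crux is
FIXED (decl `Summit.BirchSwinnertonDyer.BirchSwinnertonDyer.Theses.ShadowIsolation.ShaCotorsionReducible`);
this file registers one line for it and proves nothing else.

## Line `birth` — the rank squeeze in the Eisenstein sector (2 stubs + composition)

Greenberg's corank identity `corank Sel_{p^∞}(E/ℚ) = rank E(ℚ) + corank Ш(E/ℚ)[p^∞]` (LNM 1716,
§1) is a PROVED tree theorem (`WeierstrassCurve.selmerCorank_eq_mordellWeilRank_add_holds`), so the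
crux says exactly `corank Sel_{p^∞}(E/ℚ) ≤ rank E(ℚ)` on the sector, and every printed proof of a
case of `Ш[p^∞]`-cotorsion (Kolyvagin, Kato, Skinner–Urban; at Eisenstein primes Greenberg–Vatsal,
Castella–Grossi–Lee–Skinner) obtains it by squeezing the two sides against the analytic rank
`r_an = ord_{s=1} L(E,s)` with two DIFFERENT engines. The line names the two sides:

* `stub_selmerUB_reducible` — EULER-SYSTEM SIDE: `corank Sel_{p^∞}(E/ℚ) ≤ r_an` on the sector.
  Known when `r_an ≤ 1` (every prime: `L(E,1) ≠ 0 ⇒ Sel_{p^∞}` finite, Kolyvagin / Kato Cor. 14.3;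
  `r_an = 1 ⇒` rank `1` and `Ш` finite, Gross–Zagier–Kolyvagin) and when `corank ≤ 1` (the
  `p`-converse at an Eisenstein prime, Castella–Grossi–Lee–Skinner, Thm. E, under
  `φ|_{G_p} ≠ 1, ω`); OPEN when `min(corank, r_an) ≥ 2`. Its Eisenstein engine is in print and
  sharp: Kato's bound `corank Sel_{p^∞} ≤ ord_{T=0} L_p(E,T)` at every good ordinary `p`
  (Astérisque 295, Thm. 18.4; tree fact `kato_selmerCorank_le_order_padicLFunction`), integral by the
  Eisenstein main conjecture (Greenberg–Vatsal 2000 under a parity condition on the isogeny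
  character; Castella–Grossi–Skinner 2025), so what this stub still lacks is only the comparison
  `ord_{T=0} L_p(E,T) ≤ ord_{s=1} L(E,s)` ("no excess `p`-adic zeros") from `r_an ≥ 2`. On the sector
  it is implied by the route item `SelmerRankSmallImage` (stmt-BirchSwinnertonDyer-14418, `corank =
  r_an` at every non-surjective `p`), of which it is the upper half restricted to reducible `p`.
* `stub_rankLB_reducible` — CONSTRUCTION SIDE (load-bearing): `r_an ≤ rank E(ℚ)` on the sector.
  Known when `r_an ≤ 1` (Gross–Zagier–Kolyvagin; tree fact
  `rank_eq_analyticRank_of_analyticRank_le_one`, Darmon 2004 Thm. 3.22); OPEN from `r_an ≥ 2` — no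
  construction of two independent rational points is known on any infinite family, and the sector
  (curves with a rational `5`-, `7`- or `13`-isogeny and their twists) has unbounded conjectural rank.
* `ShaCotorsionReducible_of` — COMPOSITION (real proof; the crux BY NAME from the two stubs):
  the identity, UB and LB give `rank + corank Ш[p^∞] = corank Sel_{p^∞} ≤ r_an ≤ rank`, hence
  `corank Ш[p^∞] = 0`. Its `sorry`-free twin `shaCorank_eq_zero_of_bounds` takes the two stub
  signatures as hypotheses and concludes the crux's statement unfolded (axioms `propext`,
  `Classical.choice`, `Quot.sound`); the closing `example` shows it proves the crux decl itself.

Honesty notes. (1) The two stubs together prove more than the crux (BSD-rank on the sector as well);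
no cut of this crux into strictly weaker pieces is known — `Ш[p^∞]`-cotorsion has never been
separated from `rank = r_an` at any prime (route docstring: "never separates Ш_div from points once
r_an ≥ 2"). (2) Modulo the route's own item stmt-14418 the crux is EQUIVALENT to
`stub_rankLB_reducible` (14418 ∧ crux ⇒ LB by the identity; 14418 ⇒ UB), so LB is the load-bearing
stub; UB is kept as a stub rather than replaced by the item because its Eisenstein engine above is
strictly further along than the item's general non-surjective case. (3) The alternative `p`-adic cut
(Kato's UB, known, ∧ `ord_{T=0} L_p(E,T) ≤ rank`, open) was rejected for the birth line: its open
piece contains Schneider's non-degeneracy of the cyclotomic `p`-adic height, open already in rank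
`1`, which the crux does not need (GZK settles `r_an ≤ 1`). (4) Disproof used: none exists for this
crux yet (`ledger crux ls stmt-BirchSwinnertonDyer-15277`: no `Disproof.lean`, 2026-08-17); the
summit's negatives index has no statement about `shaCorank` on the reducible sector.

## Audit (planner-skel seat, 2026-08-17)

`lean check --json`: rc 0, errors none; sorries = 2 = stubs (`stub_selmerUB_reducible`,
`stub_rankLB_reducible`), zero elsewhere (`ShaCotorsionReducible_of` and `shaCorank_eq_zero_of_bounds`
carry no `sorry` of their own; `#print axioms shaCorank_eq_zero_of_bounds` = `propext`,
`Classical.choice`, `Quot.sound`); `ShaCotorsionReducible_of` concludes the route decl BY NAME and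
`ledger skeleton check` registers the two stubs on stmt-BirchSwinnertonDyer-15277. BC3 probes (seat folder
`bc/probe_UB.lean`, `bc/probe_LB.lean`, rc 1 each): for each stub, `stub → ShaCotorsionReducible` and
`stub → BirchSwinnertonDyer` by
`first | exact? | simpa [Stub] | (unfold Stub; simpa) | aesop (terminal) | (unfold Stub Tgt; exact?) | (unfold Stub Tgt; aesop) | (unfold Stub Tgt; simpa)`
all FAIL (4/4; the final alternative reports "Tactic assumption failed" on the unfolded implication) —
no stub is cheaply the crux or the summit. Supplementary records (`bc/probe_extra.lean`): standalone `exact?`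
after unfolding fails for all four stub → {crux, summit} pairs; dedup `example : Stub := by exact?`
fails for both stubs (neither is a theorem of the imported closure); converses: `BirchSwinnertonDyer →
stub_rankLB_reducible` SUCCEEDS by `exact?` (`Nat.le_of_eq`: LB is a consequence of the summit, as half
of BSD-rank on a sub-family must be — admissible, it is used toward the crux), while `BirchSwinnertonDyer →
stub_selmerUB_reducible`, `ShaCotorsionReducible → stub_selmerUB_reducible` and `ShaCotorsionReducible →
stub_rankLB_reducible` all fail.
-/

-- D-0017: single-problem summit, so `Summit.BirchSwinnertonDyer.BirchSwinnertonDyer.…` repeats a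
-- namespace BY DESIGN.
set_option linter.dupNamespace false

namespace Summit.BirchSwinnertonDyer.BirchSwinnertonDyer.Cruxes.ShaCotorsionReducible.Birth

/-! ## Stubs (registered; `sorry` only here) -/

/-- **Stub UB (Euler-system side; OPEN when `min(corank, r_an) ≥ 2`).** For `W/ℚ` globally minimal
elliptic and `p ≥ 5` good ordinary with `E[p]` reducible: `corank_{ℤ_p} Sel_{p^∞}(E/ℚ) ≤ ord_{s=1} L(E,s)`.
Why plausibly true: it fails iff `rank E(ℚ) > r_an` or `Ш(E/ℚ)[p^∞]` has a divisible part of corank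
`> r_an - rank`, i.e. iff BSD-rank or `Ш`-finiteness fails on the sector. Known: `r_an = 0`
(`L(E,1) ≠ 0 ⇒ E(ℚ)` and `Ш(E/ℚ)[p^∞]` finite at every `p`: Kolyvagin 1990; Kato, Astérisque 295,
Cor. 14.3), `r_an = 1` (Gross–Zagier–Kolyvagin: rank `1` and `Ш` finite), `corank = 1` (the
`p`-converse at an Eisenstein prime: Castella–Grossi–Lee–Skinner, Thm. E, under `φ|_{G_p} ≠ 1, ω`).
Engine on the sector: Kato Thm. 18.4, `corank ≤ ord_{T=0} L_p(E,T)` at every good ordinary `p` (tree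
fact `Literature.NumberTheory.EllipticCurves.kato_selmerCorank_le_order_padicLFunction`), integral by
the Eisenstein main conjecture (Greenberg–Vatsal 2000; Castella–Grossi–Skinner 2025); missing:
`ord_{T=0} L_p(E,T) ≤ r_an` from `r_an ≥ 2`. Implied on the sector by route item
stmt-BirchSwinnertonDyer-14418 (`SelmerRankSmallImage`). Size: XL (open problem).
[cite: Kato2004Asterisque, Thm. 18.4 and Cor. 14.3] [cite: CastellaEtAl2021, Thm. E]
[cite: GreenbergVatsal2000] [cite: CastellaGrossiSkinner2025] -/
theorem stub_selmerUB_reducible :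
    ∀ (W : WeierstrassCurve ℚ) [W.IsElliptic] [W.IsGloballyMinimal] (p : ℕ) [Fact p.Prime],
      5 ≤ p → W.HasGoodReductionAtPrime p → ¬ (p : ℤ) ∣ W.frobeniusTrace p →
      ¬ W.HasIrreducibleModPGaloisRep p → W.selmerCorank p ≤ W.analyticRank := by
  sorry

/-- **Stub LB (construction side; OPEN from `r_an ≥ 2`; the load-bearing stub).** For `W/ℚ`
globally minimal elliptic and `p ≥ 5` good ordinary with `E[p]` reducible:
`ord_{s=1} L(E,s) ≤ rank E(ℚ)`. Why plausibly true: it is the "enough rational points" half of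
BSD-rank on the thin family of curves admitting a rational `p`-isogeny with `p ≥ 5` of good ordinary
reduction (Mazur 1978, Thm. 1). Known: `r_an ≤ 1` (Gross–Zagier 1986 + Kolyvagin 1990; tree fact
`Literature.NumberTheory.EllipticCurves.rank_eq_analyticRank_of_analyticRank_le_one`, Darmon 2004
Thm. 3.22). Open from `r_an ≥ 2`: no construction of two independent points is known (Heegner
points are torsion once `r_an ≥ 2`: `Literature.Barriers.BirchSwinnertonDyer.HeegnerPointBarrier`).
Size: XL (open problem). [cite: Darmon2004, Thm. 3.22] [cite: GrossZagier1986] [cite: Kolyvagin1990]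
[cite: Mazur1978, Thm. 1] -/
theorem stub_rankLB_reducible :
    ∀ (W : WeierstrassCurve ℚ) [W.IsElliptic] [W.IsGloballyMinimal] (p : ℕ) [Fact p.Prime],
      5 ≤ p → W.HasGoodReductionAtPrime p → ¬ (p : ℤ) ∣ W.frobeniusTrace p →
      ¬ W.HasIrreducibleModPGaloisRep p → W.analyticRank ≤ W.mordellWeilRank := by
  sorry

/-! ## Composition: the crux from the two stubs (real proof; `sorry` enters only through the stubs) -/

/-- **Composition (line `birth`) — the skeleton theorem.** The crux `ShaCotorsionReducible`, BY
NAME, from the two registered stubs and nothing else: Greenberg's corank identity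
`corank Sel_{p^∞}(E/ℚ) = rank E(ℚ) + corank Ш[p^∞]` (LNM 1716, §1, pp. 54–57; PROVED in tree,
`WeierstrassCurve.selmerCorank_eq_mordellWeilRank_add_holds`) and `corank Sel_{p^∞} ≤ r_an ≤ rank`
(stubs UB, LB) give `corank Ш[p^∞] = 0`. This declaration contains no `sorry` of its own; its
closure reaches `sorryAx` exactly through `stub_selmerUB_reducible` and `stub_rankLB_reducible`
(the hypothesis form `shaCorank_eq_zero_of_bounds` below is the same proof over the raw stub
signatures, with axioms `propext`, `Classical.choice`, `Quot.sound` only).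
[cite: Greenberg1999LNM, §1 pp. 54–57] -/
theorem ShaCotorsionReducible_of :
    Summit.BirchSwinnertonDyer.BirchSwinnertonDyer.Theses.ShadowIsolation.ShaCotorsionReducible := by
  intro W _ _ p _ h5 hgood hord hred
  -- Greenberg's corank identity (LNM 1716 §1), a proved tree theorem
  have hId : W.selmerCorank p = W.mordellWeilRank + W.shaCorank p :=
    W.selmerCorank_eq_mordellWeilRank_add_holds p
  -- Euler-system side and construction side on the Eisenstein sector (the two stubs)
  have hub : W.selmerCorank p ≤ W.analyticRank := stub_selmerUB_reducible W p h5 hgood hord hred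
  have hlb : W.analyticRank ≤ W.mordellWeilRank := stub_rankLB_reducible W p h5 hgood hord hred
  -- squeeze: rank + corank Ш ≤ r_an ≤ rank
  omega

/-- **Composition, hypothesis form (`sorry`-free certificate).** The same proof over the two stub
SIGNATURES as hypotheses (verbatim the types of `stub_selmerUB_reducible` / `stub_rankLB_reducible`),
concluding the crux's statement unfolded (so that the skeleton audit sees exactly one theorem
concluding the crux by name, the one above): UB ∧ LB ⇒ `Ш[p^∞]`-cotorsion on the Eisenstein sector.
`#print axioms` = `propext`, `Classical.choice`, `Quot.sound`. [cite: Greenberg1999LNM, §1 pp. 54–57] -/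
theorem shaCorank_eq_zero_of_bounds
    (hUB : ∀ (W : WeierstrassCurve ℚ) [W.IsElliptic] [W.IsGloballyMinimal] (p : ℕ) [Fact p.Prime],
      5 ≤ p → W.HasGoodReductionAtPrime p → ¬ (p : ℤ) ∣ W.frobeniusTrace p →
      ¬ W.HasIrreducibleModPGaloisRep p → W.selmerCorank p ≤ W.analyticRank)
    (hLB : ∀ (W : WeierstrassCurve ℚ) [W.IsElliptic] [W.IsGloballyMinimal] (p : ℕ) [Fact p.Prime],
      5 ≤ p → W.HasGoodReductionAtPrime p → ¬ (p : ℤ) ∣ W.frobeniusTrace p →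
      ¬ W.HasIrreducibleModPGaloisRep p → W.analyticRank ≤ W.mordellWeilRank) :
    ∀ (W : WeierstrassCurve ℚ) [W.IsElliptic] [W.IsGloballyMinimal] (p : ℕ) [Fact p.Prime],
      5 ≤ p → W.HasGoodReductionAtPrime p → ¬ (p : ℤ) ∣ W.frobeniusTrace p →
      ¬ W.HasIrreducibleModPGaloisRep p → W.shaCorank p = 0 := by
  intro W _ _ p _ h5 hgood hord hred
  have hId : W.selmerCorank p = W.mordellWeilRank + W.shaCorank p :=
    W.selmerCorank_eq_mordellWeilRank_add_holds p
  have hub : W.selmerCorank p ≤ W.analyticRank := hUB W p h5 hgood hord hred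
  have hlb : W.analyticRank ≤ W.mordellWeilRank := hLB W p h5 hgood hord hred
  omega

/-- The hypothesis form IS a proof of the crux decl once the stubs are supplied (definitional
unfolding of `ShaCotorsionReducible`; kept as an `example` so that only `ShaCotorsionReducible_of`
concludes the crux by name). -/
example : Summit.BirchSwinnertonDyer.BirchSwinnertonDyer.Theses.ShadowIsolation.ShaCotorsionReducible :=
  fun W _ _ p _ h5 hgood hord hred =>
    shaCorank_eq_zero_of_bounds stub_selmerUB_reducible stub_rankLB_reducible W p h5 hgood hord hred

end Summit.BirchSwinnertonDyer.BirchSwinnertonDyer.Cruxes.ShaCotorsionReducible.Birth
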